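import Mathlib
import HarnessLib
import Summits.HubbardSuperconductivity.HubbardSuperconductivity.Theorems.KLProgrammeKLRegimeVolumeLimitNestedRates
import Summits.HubbardSuperconductivity.HubbardSuperconductivity.Theorems.KLProgrammeKLRegimeVolumeLimitCarrierRateDoor

/-!
# VL child `KLRegimeVolumeLimitV14` (stmt-HubbardSuperconductivity-19921), «cauchy» v2: the registered `stub_vl_rates` from ONE NESTED,
# FINITE-CUTOFF export of the engine — same cutoff, nested volumes, equal momenta — plus a one-volume momentum modulus
# (cell gate-hubbard-kl, seat hubbard-kl-k3c5-p3 g5, technique «OS-positivity-free direct assembly»; `--supports` 19921)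

k3c5-p2's `KLRegimeVolumeLimit.stub_vl_rates_of_carrierRate` (p498296) derives the registered `stub_vl_rates` from ONE engine statement in the engine's own
variables: a same-cutoff two-volume rate, with cross-grid torus modulus, of the BARE last-scale self-energy `klSelfEnergy L M β U μ 0 klE0 (nScales β+1) (ω,k) 0`
for ARBITRARY volume pairs `L ≤ L′`.  `…VolumeLimitNestedRates` («nested volumes suffice», shape of record, plan g13 § FINAL) shows that general position is
never needed.  This module puts the two together IN THE ENGINE'S VARIABLES (finite Matsubara cutoff, `∃ M₀ ∀ M ≥ M₀` after the volume pair):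

* `twoVolumeRate_of_nestedRate_cutoff` — ABSTRACT: for a family `T L M ω k` read at a common cutoff `M` at both volumes, a NESTED same-momentum rate
  (`L ∣ L″`, `p_{k″} = p_k`, eventually in `M`) and a ONE-volume momentum modulus (eventually in `M`) give the arbitrary-pair rate with cross-grid modulus
  (eventually in `M`; through `L″ = L·L′`, the three cutoff thresholds combined by `max`; antitone envelopes of the rates);
* `stub_vl_rates_of_nestedCarrierRate` — **the registered `stub_vl_rates` text VERBATIM** from, under the stub's binder prefix,
  (N) `∃ L₀ ρ → 0`: for `L₀ ≤ L ∣ L″`, `∃ M₀ ∀ M ≥ M₀ ∀ ω k k″`, `p_{k″} = p_k ⇒ ‖Σ̂⁰_{L,M}(ω,k) − Σ̂⁰_{L″,M}(ω,k″)‖ ≤ ρ L`, and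
  (M) `∃ L₀ D ρ′ → 0`: for `L₀ ≤ L`, `∃ M₀ ∀ M ≥ M₀ ∀ ω k₁ k₂`, `‖Σ̂⁰_{L,M}(ω,k₁) − Σ̂⁰_{L,M}(ω,k₂)‖ ≤ ρ′ L + D·Σ_i |p_{k₁} i − p_{k₂} i|_𝕋`
  — i.e. the engine's ENTIRE volume export for 19921 is: nested same-point comparability of the bare carrier at equal cutoff + a one-volume Lipschitz modulus.

Everything is proved; no definition; nothing is asserted about the model.
-/

noncomputable section

namespace Summit.HubbardSuperconductivity.HubbardSuperconductivity.Theorems.TwoPointAssembly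

set_option linter.dupNamespace false -- summit = problem name (single-conjunct summit), D-0017

open Finset Filter Topology Literature.MathematicalPhysics.QuantumLattice Literature.Probability.LatticeModels
open Literature.MathematicalPhysics.QuantumLattice.FermiRG
open Summit.HubbardSuperconductivity.HubbardSuperconductivity.Theorems.DispersionFlow
open Summit.HubbardSuperconductivity.HubbardSuperconductivity.Theorems.KLRegimeSplit
open Summit.HubbardSuperconductivity.HubbardSuperconductivity.Theorems.KLProgrammeLegKernels

/-! ## §1 The abstract reduction at a common finite cutoff -/

/-- **Nested same-momentum rate + one-volume modulus ⇒ arbitrary-pair rate with cross-grid modulus, at a common cutoff eventually in `M`.**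
`T L M ω k` is any family indexed by the volume, the cutoff, a Matsubara label at that cutoff and a torus momentum. [folklore] -/
theorem twoVolumeRate_of_nestedRate_cutoff
    {T : ∀ (L M : ℕ) [NeZero L] [NeZero M], MatsubaraIdx M → TorusSite 2 L → ℂ} {L₀ : ℕ} {D : ℝ} {ρ ρ' : ℕ → ℝ}
    (hρ : Tendsto ρ atTop (𝓝 0)) (hρ' : Tendsto ρ' atTop (𝓝 0))
    (hnest : ∀ (L : ℕ) [NeZero L], L₀ ≤ L → ∀ (L'' : ℕ) [NeZero L''], L ∣ L'' → ∃ M₀ : ℕ, ∀ (M : ℕ) [NeZero M], M₀ ≤ M →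
      ∀ (ω : MatsubaraIdx M) (k : TorusSite 2 L) (k'' : TorusSite 2 L''), latticeMomentum L'' k'' = latticeMomentum L k →
        ‖T L M ω k - T L'' M ω k''‖ ≤ ρ L)
    (hmod : ∀ (L : ℕ) [NeZero L], L₀ ≤ L → ∃ M₀ : ℕ, ∀ (M : ℕ) [NeZero M], M₀ ≤ M → ∀ (ω : MatsubaraIdx M) (k₁ k₂ : TorusSite 2 L),
      ‖T L M ω k₁ - T L M ω k₂‖ ≤ ρ' L + D * ∑ j, torusAbs (latticeMomentum L k₁ j - latticeMomentum L k₂ j)) :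
    ∃ ρ₂ : ℕ → ℝ, Tendsto ρ₂ atTop (𝓝 0) ∧
      ∀ (L : ℕ) [NeZero L], L₀ ≤ L → ∀ (L' : ℕ) [NeZero L'], L ≤ L' → ∃ M₀ : ℕ, ∀ (M : ℕ) [NeZero M], M₀ ≤ M →
        ∀ (ω : MatsubaraIdx M) (k : TorusSite 2 L) (k' : TorusSite 2 L'),
          ‖T L M ω k - T L' M ω k'‖ ≤ ρ₂ L + D * ∑ j, torusAbs (latticeMomentum L k j - latticeMomentum L' k' j) := by
  obtain ⟨σ, hσa, hσ0, hρσ, -⟩ := exists_antitone_majorant hρ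
  obtain ⟨σ', hσ'a, hσ'0, hρσ', -⟩ := exists_antitone_majorant hρ'
  refine ⟨fun L => 2 * σ L + σ' L, by simpa using (hσ0.const_mul 2).add hσ'0, fun L _ hL L' _ hLL' => ?_⟩
  haveI : NeZero (L * L') := ⟨mul_ne_zero (NeZero.ne L) (NeZero.ne L')⟩
  have hLm : L ≤ L * L' := Nat.le_mul_of_pos_right L (Nat.pos_of_ne_zero (NeZero.ne L'))
  obtain ⟨M₁, h1⟩ := hnest L hL (L * L') (dvd_mul_right L L')
  obtain ⟨M₃, h3⟩ := hnest L' (hL.trans hLL') (L * L') (dvd_mul_left L' L)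
  obtain ⟨M₂, h2⟩ := hmod (L * L') (hL.trans hLm)
  refine ⟨max M₁ (max M₂ M₃), fun M _ hM ω k k' => ?_⟩
  have hM1 : M₁ ≤ M := le_of_max_le_left hM
  have hM2 : M₂ ≤ M := le_of_max_le_left (le_of_max_le_right hM)
  have hM3 : M₃ ≤ M := le_of_max_le_right (le_of_max_le_right hM)
  obtain ⟨q, hq⟩ := exists_lift_of_dvd (dvd_mul_right L L') k
  obtain ⟨q', hq'⟩ := exists_lift_of_dvd (dvd_mul_left L' L) k'
  have e1 := h1 M hM1 ω k q hq
  have e3 := h3 M hM3 ω k' q' hq'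
  have e2 := h2 M hM2 ω q q'
  rw [hq, hq'] at e2
  calc ‖T L M ω k - T L' M ω k'‖
      ≤ ‖T L M ω k - T (L * L') M ω q‖ + ‖T (L * L') M ω q - T L' M ω k'‖ := norm_sub_le_norm_sub_add_norm_sub _ _ _
    _ ≤ ‖T L M ω k - T (L * L') M ω q‖ + (‖T (L * L') M ω q - T (L * L') M ω q'‖ + ‖T (L * L') M ω q' - T L' M ω k'‖) := by
        gcongr
        exact norm_sub_le_norm_sub_add_norm_sub _ _ _
    _ ≤ ρ L + ((ρ' (L * L') + D * ∑ j, torusAbs (latticeMomentum L k j - latticeMomentum L' k' j)) + ρ L') := by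
        rw [norm_sub_rev (T (L * L') M ω q') (T L' M ω k')]
        gcongr
    _ ≤ σ L + ((σ' L + D * ∑ j, torusAbs (latticeMomentum L k j - latticeMomentum L' k' j)) + σ L) := by
        gcongr
        · exact hρσ L
        · exact (hρσ' _).trans (hσ'a hLm)
        · exact (hρσ L').trans (hσa hLL')
    _ = (2 * σ L + σ' L) + D * ∑ j, torusAbs (latticeMomentum L k j - latticeMomentum L' k' j) := by ring

/-! ## §2 The registered `stub_vl_rates` from the nested finite-cutoff carrier rate -/

/-- **`stub_vl_rates` (stmt-…-19921, «cauchy» v2) FROM THE NESTED FINITE-CUTOFF CARRIER EXPORT.**  IF, for every datum of the registered stub,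
(N) the bare last-scale self-energy at a common cutoff is comparable across NESTED volumes at EQUAL momenta — `∃ L₀ ρ → 0`, `L₀ ≤ L ∣ L″` ⇒
`∃ M₀ ∀ M ≥ M₀ ∀ ω k k″, p_{k″} = p_k → ‖Σ̂⁰_{L,M}(ω,k) − Σ̂⁰_{L″,M}(ω,k″)‖ ≤ ρ L` — and (M) it has a ONE-volume momentum modulus — `∃ L₀ D ρ′ → 0`, `L₀ ≤ L` ⇒
`∃ M₀ ∀ M ≥ M₀ ∀ ω k₁ k₂, ‖Σ̂⁰_{L,M}(ω,k₁) − Σ̂⁰_{L,M}(ω,k₂)‖ ≤ ρ′ L + D·Σ_i |p_{k₁} i − p_{k₂} i|_𝕋` — THEN the registered text of `stub_vl_rates` holds verbatim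
(through `twoVolumeRate_of_nestedRate_cutoff` and k3c5-p2's `stub_vl_rates_of_carrierRate`). -/
theorem stub_vl_rates_of_nestedCarrierRate
    (hN : ∀ (G : GeoConsts) (P : SplitConsts) (Q : EngConsts) (R : RenConsts), G.WF → P.WF → Q.WF → R.WF →
      ∃ c₅ : ℝ, 0 < c₅ ∧ ∀ c : ℝ, 0 < c → c ≤ c₅ → ∃ U₀ : ℝ, 0 < U₀ ∧
        ∀ μ ∈ klWindowC, ∀ U : ℝ, 0 < U → U ≤ U₀ → ∀ β : ℝ, klBetaMin ≤ β → β ≤ Real.exp (c / U ^ 2) →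
          ∀ K : TrigPolyC4v, klPredsV14.frameOK R U (nScales β) μ K →
            ∀ (Lstar : ℕ) (Mstar : ℕ → ℕ), TowerP klPredsV14 G P Q R β U μ K Lstar Mstar →
              ∃ L₀ : ℕ, ∃ ρ : ℕ → ℝ, Tendsto ρ atTop (𝓝 0) ∧
                ∀ (L : ℕ) [NeZero L], L₀ ≤ L → ∀ (L'' : ℕ) [NeZero L''], L ∣ L'' → ∃ M₀ : ℕ, ∀ (M : ℕ) [NeZero M], M₀ ≤ M →
                  ∀ (ω : MatsubaraIdx M) (k : TorusSite 2 L) (k'' : TorusSite 2 L''), latticeMomentum L'' k'' = latticeMomentum L k →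
                    ‖klSelfEnergy L M β U μ 0 klE0 (nScales β + 1) (ω, k) 0 -
                        klSelfEnergy L'' M β U μ 0 klE0 (nScales β + 1) (ω, k'') 0‖ ≤ ρ L)
    (hM : ∀ (G : GeoConsts) (P : SplitConsts) (Q : EngConsts) (R : RenConsts), G.WF → P.WF → Q.WF → R.WF →
      ∃ c₅ : ℝ, 0 < c₅ ∧ ∀ c : ℝ, 0 < c → c ≤ c₅ → ∃ U₀ : ℝ, 0 < U₀ ∧
        ∀ μ ∈ klWindowC, ∀ U : ℝ, 0 < U → U ≤ U₀ → ∀ β : ℝ, klBetaMin ≤ β → β ≤ Real.exp (c / U ^ 2) →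
          ∀ K : TrigPolyC4v, klPredsV14.frameOK R U (nScales β) μ K →
            ∀ (Lstar : ℕ) (Mstar : ℕ → ℕ), TowerP klPredsV14 G P Q R β U μ K Lstar Mstar →
              ∃ L₀ : ℕ, ∃ D : ℝ, ∃ ρ' : ℕ → ℝ, Tendsto ρ' atTop (𝓝 0) ∧
                ∀ (L : ℕ) [NeZero L], L₀ ≤ L → ∃ M₀ : ℕ, ∀ (M : ℕ) [NeZero M], M₀ ≤ M →
                  ∀ (ω : MatsubaraIdx M) (k₁ k₂ : TorusSite 2 L),
                    ‖klSelfEnergy L M β U μ 0 klE0 (nScales β + 1) (ω, k₁) 0 -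
                        klSelfEnergy L M β U μ 0 klE0 (nScales β + 1) (ω, k₂) 0‖ ≤
                      ρ' L + D * ∑ i, torusAbs (latticeMomentum L k₁ i - latticeMomentum L k₂ i)) :
    ∀ (G : GeoConsts) (P : SplitConsts) (Q : EngConsts) (R : RenConsts), G.WF → P.WF → Q.WF → R.WF →
      ∃ c₅ : ℝ, 0 < c₅ ∧ ∀ c : ℝ, 0 < c → c ≤ c₅ → ∃ U₀ : ℝ, 0 < U₀ ∧
        ∀ μ ∈ klWindowC, ∀ U : ℝ, 0 < U → U ≤ U₀ → ∀ β : ℝ, klBetaMin ≤ β → β ≤ Real.exp (c / U ^ 2) →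
          ∀ K : TrigPolyC4v, klPredsV14.frameOK R U (nScales β) μ K →
            ∀ (Lstar : ℕ) (Mstar : ℕ → ℕ), TowerP klPredsV14 G P Q R β U μ K Lstar Mstar →
              ∃ L₀ : ℕ, ∃ D₂ : ℝ, ∃ ρ₁ : ℕ → ℝ, ∃ ρ₂ : ℕ → ℝ, Tendsto ρ₁ atTop (𝓝 0) ∧ Tendsto ρ₂ atTop (𝓝 0) ∧
                (∀ (L : ℕ) [NeZero L], L₀ ≤ L → ∀ (L' : ℕ) [NeZero L'], L ≤ L' → ‖klOccInf L β U μ - klOccInf L' β U μ‖ ≤ ρ₁ L) ∧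
                (∀ (L : ℕ) [NeZero L], L₀ ≤ L → ∀ (L' : ℕ) [NeZero L'], L ≤ L' →
                  ∀ (n : ℤ) (k : TorusSite 2 L) (k' : TorusSite 2 L'),
                    ‖klSixInf L β U μ n k - klSixInf L' β U μ n k'‖ ≤
                      ρ₂ L + D₂ * ∑ i, torusAbs (latticeMomentum L k i - latticeMomentum L' k' i)) := by
  refine KLRegimeVolumeLimit.stub_vl_rates_of_carrierRate ?_
  intro G P Q R hG hP hQ hR
  obtain ⟨c₁, hc₁, h₁⟩ := hN G P Q R hG hP hQ hR
  obtain ⟨c₂, hc₂, h₂⟩ := hM G P Q R hG hP hQ hR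
  refine ⟨min c₁ c₂, lt_min hc₁ hc₂, fun c hc hcle => ?_⟩
  obtain ⟨U₁, hU₁, h₁'⟩ := h₁ c hc (hcle.trans (min_le_left _ _))
  obtain ⟨U₂, hU₂, h₂'⟩ := h₂ c hc (hcle.trans (min_le_right _ _))
  refine ⟨min U₁ U₂, lt_min hU₁ hU₂, ?_⟩
  intro μ hμ U hU hUle β hβ hβle K hK Lstar Mstar hT
  obtain ⟨L₁, ρ, hρ, hnest⟩ := h₁' μ hμ U hU (hUle.trans (min_le_left _ _)) β hβ hβle K hK Lstar Mstar hT
  obtain ⟨L₂, D, ρ', hρ', hmod⟩ := h₂' μ hμ U hU (hUle.trans (min_le_right _ _)) β hβ hβle K hK Lstar Mstar hT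
  obtain ⟨ρ₂, hρ₂, hrate⟩ := twoVolumeRate_of_nestedRate_cutoff
    (T := fun L M _ _ ω k => klSelfEnergy L M β U μ 0 klE0 (nScales β + 1) (ω, k) 0) (L₀ := max L₁ L₂) (D := D) hρ hρ'
    (fun L _ hL L'' _ hdvd => hnest L (le_of_max_le_left hL) L'' hdvd) (fun L _ hL => hmod L (le_of_max_le_right hL))
  exact ⟨max L₁ L₂, D, ρ₂, hρ₂, fun L _ hL L' _ hLL' => hrate L hL L' hLL'⟩

/-! ## §3 «cauchy» v3 (d43a8bd19247ce15): the registered `stub_vl_carrierRate` text from the nested export -/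

/-- **`stub_vl_carrierRate` (stmt-…-19921, «cauchy» v3) FROM THE NESTED FINITE-CUTOFF EXPORT.**  The registered one-statement export (arbitrary volume pairs
`L ≤ L′`, common cutoff, cross-grid modulus) VERBATIM from (N) the NESTED same-momentum comparability (`L ∣ L″`, `p_{k″} = p_k`, rate `ρ L`) and (M) a ONE-volume
momentum modulus (`ρ′ L + D·Σ_i |p_{k₁} i − p_{k₂} i|_𝕋`) of the bare last-scale self-energy — so the engine lineage may land `stub_vl_carrierRate` BY NAME as
`stub_vl_carrierRate_of_nested hN hM`. -/
theorem stub_vl_carrierRate_of_nested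
    (hN : ∀ (G : GeoConsts) (P : SplitConsts) (Q : EngConsts) (R : RenConsts), G.WF → P.WF → Q.WF → R.WF →
      ∃ c₅ : ℝ, 0 < c₅ ∧ ∀ c : ℝ, 0 < c → c ≤ c₅ → ∃ U₀ : ℝ, 0 < U₀ ∧
        ∀ μ ∈ klWindowC, ∀ U : ℝ, 0 < U → U ≤ U₀ → ∀ β : ℝ, klBetaMin ≤ β → β ≤ Real.exp (c / U ^ 2) →
          ∀ K : TrigPolyC4v, klPredsV14.frameOK R U (nScales β) μ K →
            ∀ (Lstar : ℕ) (Mstar : ℕ → ℕ), TowerP klPredsV14 G P Q R β U μ K Lstar Mstar →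
              ∃ L₀ : ℕ, ∃ ρ : ℕ → ℝ, Tendsto ρ atTop (𝓝 0) ∧
                ∀ (L : ℕ) [NeZero L], L₀ ≤ L → ∀ (L'' : ℕ) [NeZero L''], L ∣ L'' → ∃ M₀ : ℕ, ∀ (M : ℕ) [NeZero M], M₀ ≤ M →
                  ∀ (ω : MatsubaraIdx M) (k : TorusSite 2 L) (k'' : TorusSite 2 L''), latticeMomentum L'' k'' = latticeMomentum L k →
                    ‖klSelfEnergy L M β U μ 0 klE0 (nScales β + 1) (ω, k) 0 -
                        klSelfEnergy L'' M β U μ 0 klE0 (nScales β + 1) (ω, k'') 0‖ ≤ ρ L)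
    (hM : ∀ (G : GeoConsts) (P : SplitConsts) (Q : EngConsts) (R : RenConsts), G.WF → P.WF → Q.WF → R.WF →
      ∃ c₅ : ℝ, 0 < c₅ ∧ ∀ c : ℝ, 0 < c → c ≤ c₅ → ∃ U₀ : ℝ, 0 < U₀ ∧
        ∀ μ ∈ klWindowC, ∀ U : ℝ, 0 < U → U ≤ U₀ → ∀ β : ℝ, klBetaMin ≤ β → β ≤ Real.exp (c / U ^ 2) →
          ∀ K : TrigPolyC4v, klPredsV14.frameOK R U (nScales β) μ K →
            ∀ (Lstar : ℕ) (Mstar : ℕ → ℕ), TowerP klPredsV14 G P Q R β U μ K Lstar Mstar →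
              ∃ L₀ : ℕ, ∃ D : ℝ, ∃ ρ' : ℕ → ℝ, Tendsto ρ' atTop (𝓝 0) ∧
                ∀ (L : ℕ) [NeZero L], L₀ ≤ L → ∃ M₀ : ℕ, ∀ (M : ℕ) [NeZero M], M₀ ≤ M →
                  ∀ (ω : MatsubaraIdx M) (k₁ k₂ : TorusSite 2 L),
                    ‖klSelfEnergy L M β U μ 0 klE0 (nScales β + 1) (ω, k₁) 0 -
                        klSelfEnergy L M β U μ 0 klE0 (nScales β + 1) (ω, k₂) 0‖ ≤
                      ρ' L + D * ∑ i, torusAbs (latticeMomentum L k₁ i - latticeMomentum L k₂ i)) :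
    ∀ (G : GeoConsts) (P : SplitConsts) (Q : EngConsts) (R : RenConsts), G.WF → P.WF → Q.WF → R.WF →
      ∃ c₅ : ℝ, 0 < c₅ ∧ ∀ c : ℝ, 0 < c → c ≤ c₅ → ∃ U₀ : ℝ, 0 < U₀ ∧
        ∀ μ ∈ klWindowC, ∀ U : ℝ, 0 < U → U ≤ U₀ → ∀ β : ℝ, klBetaMin ≤ β → β ≤ Real.exp (c / U ^ 2) →
          ∀ K : TrigPolyC4v, klPredsV14.frameOK R U (nScales β) μ K →
            ∀ (Lstar : ℕ) (Mstar : ℕ → ℕ), TowerP klPredsV14 G P Q R β U μ K Lstar Mstar →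
              ∃ L₀ : ℕ, ∃ D : ℝ, ∃ ρ : ℕ → ℝ, Tendsto ρ atTop (𝓝 0) ∧
                ∀ (L : ℕ) [NeZero L], L₀ ≤ L → ∀ (L' : ℕ) [NeZero L'], L ≤ L' → ∃ M₀ : ℕ, ∀ (M : ℕ) [NeZero M], M₀ ≤ M →
                  ∀ (ω : MatsubaraIdx M) (k : TorusSite 2 L) (k' : TorusSite 2 L'),
                    ‖klSelfEnergy L M β U μ 0 klE0 (nScales β + 1) (ω, k) 0 -
                        klSelfEnergy L' M β U μ 0 klE0 (nScales β + 1) (ω, k') 0‖ ≤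
                      ρ L + D * ∑ i, torusAbs (latticeMomentum L k i - latticeMomentum L' k' i) := by
  intro G P Q R hG hP hQ hR
  obtain ⟨c₁, hc₁, h₁⟩ := hN G P Q R hG hP hQ hR
  obtain ⟨c₂, hc₂, h₂⟩ := hM G P Q R hG hP hQ hR
  refine ⟨min c₁ c₂, lt_min hc₁ hc₂, fun c hc hcle => ?_⟩
  obtain ⟨U₁, hU₁, h₁'⟩ := h₁ c hc (hcle.trans (min_le_left _ _))
  obtain ⟨U₂, hU₂, h₂'⟩ := h₂ c hc (hcle.trans (min_le_right _ _))
  refine ⟨min U₁ U₂, lt_min hU₁ hU₂, ?_⟩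
  intro μ hμ U hU hUle β hβ hβle K hK Lstar Mstar hT
  obtain ⟨L₁, ρ, hρ, hnest⟩ := h₁' μ hμ U hU (hUle.trans (min_le_left _ _)) β hβ hβle K hK Lstar Mstar hT
  obtain ⟨L₂, D, ρ', hρ', hmod⟩ := h₂' μ hμ U hU (hUle.trans (min_le_right _ _)) β hβ hβle K hK Lstar Mstar hT
  obtain ⟨ρ₂, hρ₂, hrate⟩ := twoVolumeRate_of_nestedRate_cutoff
    (T := fun L M _ _ ω k => klSelfEnergy L M β U μ 0 klE0 (nScales β + 1) (ω, k) 0) (L₀ := max L₁ L₂) (D := D) hρ hρ'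
    (fun L _ hL L'' _ hdvd => hnest L (le_of_max_le_left hL) L'' hdvd) (fun L _ hL => hmod L (le_of_max_le_right hL))
  exact ⟨max L₁ L₂, D, ρ₂, hρ₂, fun L _ hL L' _ hLL' => hrate L hL L' hLL'⟩

end Summit.HubbardSuperconductivity.HubbardSuperconductivity.Theorems.TwoPointAssembly

end
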